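import Summits.BirchSwinnertonDyer.Rank1Residual.GaloisImage.ThreeCongruenceHesseCertificatesBatch6
import Literature.NumberTheory.EllipticCurves.Fisher2012.HesseFamilyThreeReverseProofs
import Summits.BirchSwinnertonDyer.Rank1Residual.Additive.X4ThreeVisibleRowShape38808bu1
import Summits.BirchSwinnertonDyer.Rank1Residual.Additive.X4ThreeVisibleRowShape39456l1
import Summits.BirchSwinnertonDyer.BirchSwinnertonDyer.Theorems.Rank2ObservatoryKernelCerts1127
import Summits.BirchSwinnertonDyer.BirchSwinnertonDyer.Theorems.Rank2ObservatoryKernelCertsT09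
import HarnessLib

/-!
# T-VIS3-REC row shapes with the C-VIS `θ/hθ` column AND the rank column DISCHARGED IN THE KERNEL —
# batch `Batch6b`: 38808bu1, 39456l1
# (cell `b2b-bsdres`, team n1011, ROW T-VIS3-TH; seat p07 lineage; skeleton cells/n1011/skel/T-VIS3-TH.md;
# generated by `tools/gen_twins.py` from the TREE text of the p18-lineage shapes — consumed BY NAME, nothing edited)

HONEST FRAMING (cell `b2b-bsdres`, run/shared/lean/b2b/bsd-rank1-residual/, verbatim in every
file): the goal of the cell is to DELETE the COMBINATION-SHAPED residual classes of the
Birch–Swinnerton-Dyer formula for ALL analytic-rank `≤ 1` elliptic curves over `ℚ` — "full BSD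
formula for every rank `≤ 1` curve in class `C`" assembled STRICTLY from published theorems — so
that the rank-`≤ 1` remainder becomes exactly the CONSTRUCTION-SHAPED classes, which are TYPED
(missing-input `Prop`s), NOT attempted. This is not "finishing BSD". Team n1011 (N11 = X4 ∧ `p = 3`):
research route; RECORD theorems only — NO definition, NO new named fact, NO `sorry`; a record closes
NO class and moves no mark / label / count; nothing booked; census count unchanged.

## What

Same construction as `Additive/X4ThreeVisibleRowShapesThetaFree.lean` (ROW T-VIS3-TH FILE 2): for each row
`bsdp3_visHesse_v<E>` := `bsdp3_vis_v<E>` with `(W') (hW') [W'.IsElliptic] (θ) (hθ)` ↦ the literal partner +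
`VisCerts.torsionIso3_<E′>_<E>_of_integralModelInt` (`GaloisImage/ThreeCongruenceHesseCertificatesBatch6`; DUAL pairs are unconditional — A243 is the tree theorem
`Fisher2012.thm132rev_threeCongruent_dualHessePencil_holds`, inside the certificate file or fed here) and `(hrank)` ↦ the
bsd-rank2-observatory kernel certificate of the partner (per-curve `KernelCerts<f>.C<E′>.two_le_rank` or the
walker list `two_le_mordellWeilRank_of_mem_kernelCertRowsW<f>`), BY NAME.

| row | partner | kind | θ certificate | rank certificate |
|---|---|---|---|---|
| 38808bu1 | 4312l1 | (G) | dual | percurve |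
| 39456l1 | 39456k1 | (M) | direct | percurve |

Binders left per row: the named facts of the (M)/(G) chain, `hr : r_an = 0`, `hq/hv : ord₃ #Ш_an ≤ 2`
(+ `D/hc` on (G) rows). References: [CremonaMazur2000] §3; [Fisher2012Hessian] Thm. 13.2 / §13;
[CremonaAlgorithms1997] §3.5; [SilvermanAEC2009] VIII.6.7.
-/

set_option autoImplicit false

noncomputable section

open scoped Classical NumberField
open IsDedekindDomain NumberField WeierstrassCurve Rat.HeightOneSpectrum
  Literature.NumberTheory.EllipticCurves Literature.NumberTheory.EllipticCurves.ModularForms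
  Literature.NumberTheory.EllipticCurves.Rank1Residual
  Literature.NumberTheory.EllipticCurves.Rank1Residual.Typed
  Literature.NumberTheory.EllipticCurves.Fisher2012
  Literature.NumberTheory.GaloisRepresentations
  Summit.BirchSwinnertonDyer.BirchSwinnertonDyer.Rank1Residual.IntModel
  Summit.BirchSwinnertonDyer.BirchSwinnertonDyer.Rank1Residual.X11RankOne
  Summit.BirchSwinnertonDyer.BirchSwinnertonDyer.Rank2Observatory.Tam
  Summit.BirchSwinnertonDyer.BirchSwinnertonDyer.Rank2Observatory
  Summit.BirchSwinnertonDyer.Rank1Residual.GaloisImage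

namespace Summit.BirchSwinnertonDyer.Rank1Residual.Additive

/-- **T-VIS3 row `38808bu1` ((G); partner `4312l1`, DUAL certificate — A243 by
`thm132rev_threeCongruent_dualHessePencil_holds`) with θ/hθ AND hrank DISCHARGED** — p18-lineage
shape `bsdp3_vis_v38808bu1` fed with `VisCerts.torsionIso3_4312l1_38808bu1_of_integralModelInt` and
the bsdr2 kernel certificate `KernelCertsT09.C4312l1.two_le_rank`. BINDERS LEFT = {named facts, hr,
hq/hv, D/hc}; closes nothing beyond them; nothing booked; census count unchanged.
[cite: CremonaMazur2000, §3 and Table 1] [cite: Fisher2012Hessian, §13 (analogue of Thm. 13.2 for X_E^-(3))] -/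
theorem bsdp3_visHesse_v38808bu1
    (hKato : Kato2004.rankZero_padicValNat_sha_le_of_additive_potGood_of_imageContainsSL2)
    (hCT : exists_casselsTate_pairing (K := ℚ))
    (hGZK : rank_eq_analyticRank_of_analyticRank_le_one) (hmod : hasEntireLFunction_rat)
    (W : WeierstrassCurve ℚ) [W.IsElliptic] [W.IsGloballyMinimal]
    (hI : integralModelInt W = ⟨0, 0, 0, 9261, -4537890⟩)
    (hr : W.analyticRank = 0)
    {N : ℕ} [NeZero N] (D : ModularParametrizationData W N) (hc : ¬ ((3 : ℕ) : ℤ) ∣ D.maninConstant)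
    {q : ℚ} (hq : shaAn W = (q : ℂ)) (hv : padicValRat 3 q ≤ 2) :
    haveI : Fact (Nat.Prime 3) := ⟨Nat.prime_three⟩
    BSDp W 3 := by
  haveI : (⟨0, 1, 0, -100, 384⟩ : WeierstrassCurve ℚ).IsElliptic :=
    ⟨by rw [isUnit_iff_ne_zero]
        norm_num [WeierstrassCurve.Δ, WeierstrassCurve.b₂, WeierstrassCurve.b₄, WeierstrassCurve.b₆,
          WeierstrassCurve.b₈]⟩
  obtain ⟨θ, hθ⟩ := VisCerts.torsionIso3_4312l1_38808bu1_of_integralModelInt W hI ⟨0, 1, 0, -100, 384⟩ rfl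
  have hE' : (⟨0, 1, 0, -100, 384⟩ : WeierstrassCurve ℤ).map (Int.castRingHom ℚ) =
      (⟨0, 1, 0, -100, 384⟩ : WeierstrassCurve ℚ) := by
    ext <;> simp [WeierstrassCurve.map]
  have hrank : 2 ≤ (⟨0, 1, 0, -100, 384⟩ : WeierstrassCurve ℚ).mordellWeilRank := by
    rw [← hE']; exact KernelCertsT09.C4312l1.two_le_rank
  exact bsdp3_vis_v38808bu1 hKato hCT hGZK hmod W hI hr D hc hq hv _ rfl θ hθ hrank

/-- **T-VIS3 row `39456l1` ((M); partner `39456k1`, DIRECT certificate) with θ/hθ AND hrank DISCHARGED**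
— p18-lineage shape `bsdp3_vis_v39456l1` fed with
`VisCerts.torsionIso3_39456k1_39456l1_of_integralModelInt` and the bsdr2 kernel certificate
`KernelCerts1127.C39456k1.two_le_rank`. BINDERS LEFT = {named facts, hr, hq/hv}; closes nothing
beyond them; nothing booked; census count unchanged.
[cite: CremonaMazur2000, §3 and Table 1] [cite: Fisher2012Hessian, Thm. 13.2 (n = 3)] -/
theorem bsdp3_visHesse_v39456l1
    (hKatoS : Kato2004.rankZero_padicValNat_sha_le_sub_localTamagawa_of_additive_potGood_of_imageContainsSL2)
    (hDel : Delbourgo1998.prop4_rankZero_pow_dvd_constantCoeff)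
    (hGZK : rank_eq_analyticRank_of_analyticRank_le_one) (hmod : hasEntireLFunction_rat)
    (hmodD : nonempty_modularParametrizationData)
    (hKatoχ : Wuthrich2014.kato_halfEigenCharIdeal_dvd_cyclotomicPrime_of_surjective)
    (hCT : exists_casselsTate_pairing (K := ℚ))
    (W : WeierstrassCurve ℚ) [W.IsElliptic] [W.IsGloballyMinimal]
    (hI : integralModelInt W = ⟨0, 0, 0, -3693, -86380⟩)
    (hr : W.analyticRank = 0)
    {q : ℚ} (hq : shaAn W = (q : ℂ)) (hv : padicValRat 3 q ≤ 2) :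
    haveI : Fact (Nat.Prime 3) := ⟨Nat.prime_three⟩
    BSDp W 3 := by
  haveI : (⟨0, 0, 0, -23817, 1414748⟩ : WeierstrassCurve ℚ).IsElliptic :=
    ⟨by rw [isUnit_iff_ne_zero]
        norm_num [WeierstrassCurve.Δ, WeierstrassCurve.b₂, WeierstrassCurve.b₄, WeierstrassCurve.b₆,
          WeierstrassCurve.b₈]⟩
  obtain ⟨θ, hθ⟩ := VisCerts.torsionIso3_39456k1_39456l1_of_integralModelInt W hI ⟨0, 0, 0, -23817, 1414748⟩ rfl
  have hE' : (⟨0, 0, 0, -23817, 1414748⟩ : WeierstrassCurve ℤ).map (Int.castRingHom ℚ) =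
      (⟨0, 0, 0, -23817, 1414748⟩ : WeierstrassCurve ℚ) := by
    ext <;> simp [WeierstrassCurve.map]
  have hrank : 2 ≤ (⟨0, 0, 0, -23817, 1414748⟩ : WeierstrassCurve ℚ).mordellWeilRank := by
    rw [← hE']; exact KernelCerts1127.C39456k1.two_le_rank
  exact bsdp3_vis_v39456l1 hKatoS hDel hGZK hmod hmodD hKatoχ hCT W hI hr hq hv _ rfl θ hθ hrank

end Summit.BirchSwinnertonDyer.Rank1Residual.Additive

end
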